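import Summits.ResolutionOfSingularities.ResolutionOfSingularities.Theorems.EquisingularLiftEquisingularLiftNatDirZeroDefs
import Literature.AlgebraicGeometry.Resolution.Dehomogenization
import Literature.AlgebraicGeometry.Resolution.MarkedIdeals
import HarnessLib

/-!
# Route `EquisingularLift`, crux EL♮ (stmt-ResolutionOfSingularities-20038) / EL♮(3) (stmt-…-20148) — named DOWNSTAIRS predicates
# of the lead's skeleton, rung v7′ (TC⁺⁺ «in-carrier point steps at a NON-SUPERABUNDANT CLUSTER of singular points of the carrier curve, then the curve»)

res-L1-w45b-lead-2 g1 (lead) with res-L1-w45b-stub-3 (the `CarrierFrame` / `ReducedConeForm` / `FatCluster` / `ClusterNonSuperabundant` /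
`CarrierCluster` / `ClusterReach` clauses = fragment `L/res-L1-w45b-stub-3/CLUSTERSTEP.lean` 613808d2f3875cab, delivered on the lead's deal (D1)
2026-08-27T11:55:26Z, VERBATIM). OURS; planning vocabulary of the crux chain, not a statement of any manuscript; AI-written, weaker than expert
review. Every predicate is DOWNSTAIRS-ONLY (objects on the `k`-side stages; the residue model `πk : 𝒪_{F₁,x} ↠ k'` is abstract, the supplier
identifies `k'` with the route's `k` through its model square).

* stub-3's clauses (docstrings below): the frame-with-initial-form at the stalk (`CarrierFrame`, res-type-100 F4 / T-FRAME-AT p527425 currency),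
  the reduced tangent form (`ReducedConeForm`, res-L1-w45b-stub-2 T-PTPRIME-DICT p526020 currency), the fat cluster of singular points with EXACT
  orders covering `Sing V(g)` (`FatCluster`), T-CLUSTER-LIFT's independence hypothesis `hind` (`ClusterNonSuperabundant`, p524424; automatic for
  `Σ m ≤ deg g + 1`, p527698; equivalent to a surjectivity, p528441), their conjunction on the initial data (`CarrierCluster`), and the inner
  in-carrier point closure with an EXCEPTIONAL TRACKER `X` instead of rung v7's one-singular-point flag (`ClusterReach`: regular points of the
  running carrier curve anywhere, NON-regular points only OFF the inner exceptional locus — proper singular points of `Z₂`, never infinitely-near ones).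
* `ReachTCPlusPlus F₁ F₂ υ x T₂ F' β T'` — the ADMISSIBLE SUB-CHAIN PREDICATE of rung v7′ for K5′'s slot `Reach` (res-D-pv-029
  `target_elnat_of_subchainResolution'`, p523491): the four `W`-clauses of rung v7 (`x ∈ W` locally principal, `¬ υ⁻¹{x} ⊆ St W`,
  `Z₂ := υ⁻¹{x} ∩ St W ⊆ T₂`) ∧ `CarrierCluster` ∧ `ClusterReach` to `(F₉, β₉, T₉, Z₉)` ∧ the final carrier-curve blow-up `υ' : F' → F₉`
  (`Z₉ ⊆ T₉`, `T₉ ⊄ Z₉`, finitely many singular points, `IsBlowup υ' (vanishingIdeal Z₉)`), `β = υ' ≫ β₉`, `T' = closure υ'⁻¹(T₉ ∖ Z₉)`.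
  (Pure TC⁺⁺ — no direction steps; the combined TC⁺⁺ ⊕ DIR₀ predicate is a later successor.)

The registered v7′ stub = K5′'s downstairs hypothesis at `Reach := ReachTCPlusPlus` ⇒ horizontal EL♮; conditional instance = one application of
K5′; upstairs debt HSUB′(ReachTCPlusPlus) = res-L1-w45b-stub-1's HSUB′(ReachTC⁺) architecture with ONE member centred at the whole cluster
(res-L1-w45b-stub-3 T-CLUSTER-LIFT parts 1–8: the cluster cone, Δ-regular off the cluster, equimultiple along every section).
-/

set_option linter.dupNamespace false

noncomputable section

open CategoryTheory AlgebraicGeometry TopologicalSpace IsLocalRing MvPolynomial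
open Literature.AlgebraicGeometry.Resolution (IsBlowup dehomogenize stalkIdeal)

namespace Summit.ResolutionOfSingularities.ResolutionOfSingularities.Cruxes.EquisingularLiftNat.Sections

/-- **CLUSTERSTEP / (a) `CarrierFrame`** — «coordinates on the exceptional plane» in the supplier kit's currency: a frame
`c = (c₀, c₁, c₂)` of the stalk `𝒪_{F₁,x}` GENERATING `𝔪_x` (so `e = υ⁻¹{x} = Proj κ(x)[T₀,T₁,T₂]` with `T_l ↔ c_l`, res-type-100 F4 /
Hartshorne II 8.24 (b)), together with the INITIAL FORM of `W` at `x`: a form `Φ ∈ 𝒪_{F₁,x}[T₀,T₁,T₂]` of degree `d` with non-zero reduction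
modulo `(c)` and `𝓘(closure W)_x = (Φ(c))` (res-type-097 T-TCONE `exists_isHomogeneous_of_stalkIdeal_eq_span`). Downstairs only. -/
def CarrierFrame (F₁ : Scheme.{0}) (x : F₁) (W : Set F₁) (c : Fin 3 → F₁.presheaf.stalk x) (d : ℕ)
    (Φ : MvPolynomial (Fin 3) (F₁.presheaf.stalk x)) : Prop :=
  Ideal.span (Set.range c) = maximalIdeal (F₁.presheaf.stalk x) ∧ Φ.IsHomogeneous d ∧
    MvPolynomial.map (Ideal.Quotient.mk (Ideal.span (Set.range c))) Φ ≠ 0 ∧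
    stalkIdeal (Scheme.IdealSheafData.vanishingIdeal (⟨closure W, isClosed_closure⟩ : Closeds F₁)) x =
      Ideal.span {MvPolynomial.eval c Φ}

/-- **CLUSTERSTEP / `ReducedConeForm`** — the REDUCED TANGENT FORM `g` of `W` at `x` read over a residue model `πk : 𝒪_{F₁,x} → k'`:
`g ∈ k'[T₀,T₁,T₂]` homogeneous of degree `dg`, cutting out the same set as the reduced initial form (R1: `π_*Φ ∈ √(g)` and `g ∈ √(π_*Φ)`)
and reduced on every chart (R2: `(g(T_j := 1))` radical) — res-L1-w45b-stub-2's T-PTPRIME-DICT hypotheses (p526020) verbatim over `k'`,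
so that `Z₂ = υ⁻¹{x} ∩ closure υ⁻¹(W ∖ {x}) = V₊(g)` with its reduced structure (res-type-097 T-TCONE part 2). Downstairs only. -/
def ReducedConeForm {R k' : Type} [CommRing R] [CommRing k'] (πk : R →+* k') (Φ : MvPolynomial (Fin 3) R) (dg : ℕ)
    (g : MvPolynomial (Fin 3) k') : Prop :=
  g.IsHomogeneous dg ∧
    MvPolynomial.map πk Φ ∈ (Ideal.span {g}).radical ∧ g ∈ (Ideal.span {MvPolynomial.map πk Φ}).radical ∧
    ∀ j : Fin 3, (Ideal.span {dehomogenize j g}).IsRadical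

/-- **CLUSTERSTEP / `FatCluster`** — a FAT CLUSTER of points of the plane curve `V(g) ⊂ ℙ²_{k'}`: `s` points, point `t` read on the chart
`T_{i t} ≠ 0` with affine coordinates `a t : {j // j ≠ i t} → k'` (homogeneous vector `â_t = (l ↦ if l = i t then 1 else a t l)`), orders `m t`:
(EXACT ORDER) `g(T_{i t} := 1) ∈ 𝔪_{a t}^{m t} ∖ 𝔪_{a t}^{m t + 1}` (`m t = mult_{q_t} V(g)` — the order the upstairs cone must have along the
section, equality making it EQUIMULTIPLE, res-L1-w45b-stub-3 T-M1-EXACT p515745); (DISTINCT) `â_{t'}` is no multiple of `â_t` for `t ≠ t'`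
(T-CLUSTER-LIFT part 5 spelling); (COVER) on every chart `j`, every prime `𝔮 ∋ g(T_j := 1)` of `k'[T_{l ≠ j}]` at which `g(T_j := 1) ∈ 𝔪_𝔮²`
(a NON-REGULAR point of the trace — res-type-032's «bad prime», T-PTPRIME-DICT's image of a non-regular point of `V(Z₂)_red`) is the
point ideal on chart `j` of a cluster member visible there: `â_t j ≠ 0` and `𝔮 = (X_l − (â_t l / â_t j) : l ≠ j)`. So the cluster
CONTAINS every singular point of `V(g)` (it may contain regular points too, with `m t = 1`). Pure algebra; downstairs only. -/
def FatCluster {k' : Type} [Field k'] (g : MvPolynomial (Fin 3) k') (s : ℕ) (i : Fin s → Fin 3)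
    (a : (t : Fin s) → {j : Fin 3 // j ≠ i t} → k') (m : Fin s → ℕ) : Prop :=
  (∀ t, dehomogenize (i t) g ∈
      (Ideal.span (Set.range fun j => (X j : MvPolynomial {j : Fin 3 // j ≠ i t} k') - C (a t j))) ^ m t ∧
    dehomogenize (i t) g ∉
      (Ideal.span (Set.range fun j => (X j : MvPolynomial {j : Fin 3 // j ≠ i t} k') - C (a t j))) ^ (m t + 1)) ∧
  (∀ t t', t ≠ t' → ¬ ∃ r : k', (fun l : Fin 3 => if h : l = i t' then (1 : k') else a t' ⟨l, h⟩) =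
      r • (fun l : Fin 3 => if h : l = i t then (1 : k') else a t ⟨l, h⟩)) ∧
  (∀ (j : Fin 3) (𝔮 : PrimeSpectrum (MvPolynomial {l : Fin 3 // l ≠ j} k')),
      dehomogenize j g ∈ 𝔮.asIdeal →
      algebraMap (MvPolynomial {l : Fin 3 // l ≠ j} k') (Localization.AtPrime 𝔮.asIdeal) (dehomogenize j g) ∈
        maximalIdeal (Localization.AtPrime 𝔮.asIdeal) ^ 2 →
      ∃ t : Fin s, (if h : j = i t then (1 : k') else a t ⟨j, h⟩) ≠ 0 ∧
        𝔮.asIdeal = Ideal.span (Set.range fun l : {l : Fin 3 // l ≠ j} =>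
          (X l : MvPolynomial {l : Fin 3 // l ≠ j} k') -
            C ((if h : (l : Fin 3) = i t then (1 : k') else a t ⟨l, h⟩) / (if h : j = i t then (1 : k') else a t ⟨j, h⟩))))

/-- **CLUSTERSTEP / (b) `ClusterNonSuperabundant`** — the fat cluster `{m t · â_t}` imposes INDEPENDENT CONDITIONS on the forms of degree
`dg`: every family of jets `v t` (coefficients of degree `< m t` of the shifted dehomogenisation at `a t`) is the family of jets of ONE form
of degree `dg` — T-CLUSTER-LIFT's hypothesis `hind` VERBATIM (…NatClusterLift p524424 `exists_isHomogeneous_lift_forall_dehomogenize_mem_pow`,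
binders `(i, a, m)` as here with `σ := Fin 3`, `ι := Fin s`). Equivalent: `k'[T]_{dg} → Π_t k'[U]/𝔪_{a t}^{m t}` onto
(`hind_iff_quotient_surjective`, p528441) = «`H⁰(𝒪_e(dg)) → ⊕_t 𝒪_{e,q_t}/𝔪^{m t}` onto, `h¹ = 0`»; AUTOMATIC when `Σ_t m t ≤ dg + 1`
(`exists_isHomogeneous_forall_coeff_eq_charts`, p527698), FALSE e.g. for F₇⁻ (`Σ m = 21 > 8`). Pure algebra; downstairs only. -/
def ClusterNonSuperabundant {k' : Type} [Field k'] (dg : ℕ) (s : ℕ) (i : Fin s → Fin 3)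
    (a : (t : Fin s) → {j : Fin 3 // j ≠ i t} → k') (m : Fin s → ℕ) : Prop :=
  ∀ v : (t : Fin s) → ({j : Fin 3 // j ≠ i t} →₀ ℕ) → k', ∃ g' : MvPolynomial (Fin 3) k', g'.IsHomogeneous dg ∧
    ∀ t (α : {j : Fin 3 // j ≠ i t} →₀ ℕ), α.degree < m t →
      coeff α (aeval (fun j => (X j : MvPolynomial {j : Fin 3 // j ≠ i t} k') + C (a t j)) (dehomogenize (i t) g')) = v t α

/-- **CLUSTERSTEP / (a)+(b) `CarrierCluster`** — the clause of rung v7′ ON THE INITIAL DATA `(F₁, x, W)` of the (TC) step: there are a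
carrier frame with initial form (`CarrierFrame`), a residue model `πk : 𝒪_{F₁,x} ↠ k'` with `ker πk = (c)` (any field `k'`; the supplier
identifies it with the route's `k` through its model square), a reduced tangent form `g` (`ReducedConeForm`), and a fat cluster of its points
(`FatCluster`: exact orders, distinct, covering every singular point) which is NON-SUPERABUNDANT (`ClusterNonSuperabundant`). Downstairs only;
on a specimen one exhibits `c, Φ, k' := k, g` and the list of singular points with their multiplicities and checks `Σ m ≤ deg g + 1` or the
rank condition. -/
def CarrierCluster (F₁ F₂ : Scheme.{0}) (_υ : F₂ ⟶ F₁) (x : F₁) (W : Set F₁) : Prop :=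
  ∃ (c : Fin 3 → F₁.presheaf.stalk x) (d : ℕ) (Φ : MvPolynomial (Fin 3) (F₁.presheaf.stalk x)),
    CarrierFrame F₁ x W c d Φ ∧
    ∃ (k' : Type) (_ : Field k') (πk : F₁.presheaf.stalk x →+* k'),
      Function.Surjective πk ∧ RingHom.ker πk = Ideal.span (Set.range c) ∧
      ∃ (dg : ℕ) (g : MvPolynomial (Fin 3) k'), ReducedConeForm πk Φ dg g ∧
        ∃ (s : ℕ) (i : Fin s → Fin 3) (a : (t : Fin s) → {j : Fin 3 // j ≠ i t} → k') (m : Fin s → ℕ),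
          FatCluster g s i a m ∧ ClusterNonSuperabundant dg s i a m

/-- **CLUSTERSTEP / (c) `ClusterReach`** — the INNER in-carrier point closure of TC⁺⁺ from `(F₂, 𝟙, T₂, Z₂, X := ∅)` to `(F₉, β₉, T₉, Z₉)`:
the (TC⁺) closure of the registered `stub_elnat_tcPlusPointResolution` WITHOUT its one-singular-point flag, with an EXCEPTIONAL TRACKER
`X` instead (the union of the inner exceptional curves): a point blow-up `υ₁ : G₂ → G₁` at a closed point `y` of `V(closure Z)_red` with
`y ∈ T` and `G₁` regular at `y` is admissible when EITHER `y` is a REGULAR point of the curve (any position), OR `y` is a NON-REGULAR point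
with `y ∉ X` — a singular point of `Z₂` itself seen through the local isomorphism `β`, never an infinitely-near singular point; the stage
becomes `(G₂, υ₁ ≫ β, closure υ₁⁻¹(T ∖ {y}), closure υ₁⁻¹(Z ∖ {y}), closure υ₁⁻¹(X ∖ {y}) ∪ υ₁⁻¹{y})`. Downstairs only. -/
def ClusterReach (F₂ : Scheme.{0}) (T₂ Z₂ : Set F₂) (F₉ : Scheme.{0}) (β₉ : F₉ ⟶ F₂) (T₉ Z₉ : Set F₉) : Prop :=
  ∃ X₉ : Set F₉, ∀ R : (∀ G : Scheme.{0}, (G ⟶ F₂) → Set G → Set G → Set G → Prop),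
    R F₂ (𝟙 F₂) T₂ Z₂ ∅ →
    (∀ (G₁ G₂ : Scheme.{0}) (β : G₁ ⟶ F₂) (T Z X : Set G₁) (y : redSub G₁ (closure Z) isClosed_closure) (υ₁ : G₂ ⟶ G₁)
        (hy : IsClosed ({(redSubι G₁ (closure Z) isClosed_closure y : G₁)} : Set G₁)),
      R G₁ β T Z X →
      (redSubι G₁ (closure Z) isClosed_closure y : G₁) ∈ T →
      IsRegularLocalRing (G₁.presheaf.stalk (redSubι G₁ (closure Z) isClosed_closure y)) →
      (IsRegularLocalRing ((redSub G₁ (closure Z) isClosed_closure).presheaf.stalk y) ∨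
        (¬ IsRegularLocalRing ((redSub G₁ (closure Z) isClosed_closure).presheaf.stalk y) ∧
          (redSubι G₁ (closure Z) isClosed_closure y : G₁) ∉ X)) →
      IsBlowup υ₁ (Scheme.IdealSheafData.vanishingIdeal
        (⟨{(redSubι G₁ (closure Z) isClosed_closure y : G₁)}, hy⟩ : Closeds G₁)) →
      R G₂ (υ₁ ≫ β) (closure (υ₁ ⁻¹' (T \ {(redSubι G₁ (closure Z) isClosed_closure y : G₁)})))
        (closure (υ₁ ⁻¹' (Z \ {(redSubι G₁ (closure Z) isClosed_closure y : G₁)})))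
        (closure (υ₁ ⁻¹' (X \ {(redSubι G₁ (closure Z) isClosed_closure y : G₁)})) ∪
          υ₁ ⁻¹' {(redSubι G₁ (closure Z) isClosed_closure y : G₁)})) →
    R F₉ β₉ T₉ Z₉ X₉

/-- **ReachTCPlusPlus** — the admissible downstairs sub-chain predicate of rung v7′ (TC⁺⁺) for K5′'s slot `Reach` (module docstring):
rung v7's `W`-clauses, `CarrierCluster` (non-superabundant fat cluster of the singular points of the carrier curve `Z₂ = υ⁻¹{x} ∩ St W`),
the tracker closure `ClusterReach`, then the blow-up of the carrier curve; ending at `(F', β = υ' ≫ β₉, T' = closure υ'⁻¹(T₉ ∖ Z₉))`. -/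
def ReachTCPlusPlus (F₁ F₂ : AlgebraicGeometry.Scheme.{0}) (υ : F₂ ⟶ F₁) (x : F₁) (T₂ : Set F₂)
    (F' : AlgebraicGeometry.Scheme.{0}) (β : F' ⟶ F₂) (T' : Set F') : Prop :=
  ∃ (W : Set F₁) (F₉ : AlgebraicGeometry.Scheme.{0}) (β₉ : F₉ ⟶ F₂) (T₉ Z₉ : Set F₉) (hZ₉ : IsClosed Z₉) (υ' : F' ⟶ F₉),
    (x ∈ W) ∧ (¬ (υ ⁻¹' {x} ⊆ closure (υ ⁻¹' (W \ {x})))) ∧ ((∃ U : F₁.affineOpens, x ∈ (U : F₁.Opens) ∧ ((AlgebraicGeometry.Scheme.IdealSheafData.vanishingIdeal (⟨closure W, isClosed_closure⟩ : TopologicalSpace.Closeds F₁)).ideal U).IsPrincipal)) ∧ ((υ ⁻¹' {x} ∩ closure (υ ⁻¹' (W \ {x}))) ⊆ T₂) ∧ CarrierCluster F₁ F₂ υ x W ∧ ClusterReach F₂ T₂ (υ ⁻¹' {x} ∩ closure (υ ⁻¹' (W \ {x}))) F₉ β₉ T₉ Z₉ ∧ (Z₉ ⊆ T₉) ∧ (¬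 (T₉ ⊆ Z₉)) ∧ (Set.Finite {z : ↥((AlgebraicGeometry.Scheme.IdealSheafData.vanishingIdeal (⟨Z₉, hZ₉⟩ : TopologicalSpace.Closeds F₉))).subscheme | ¬ IsRegularLocalRing (((AlgebraicGeometry.Scheme.IdealSheafData.vanishingIdeal (⟨Z₉, hZ₉⟩ : TopologicalSpace.Closeds F₉))).subscheme.presheaf.stalk z)}) ∧ (Literature.AlgebraicGeometry.Resolution.IsBlowup υ' (AlgebraicGeometry.Scheme.IdealSheafData.vanishingIdeal (⟨Z₉, hZ₉⟩ : TopologicalSpace.Closeds F₉))) ∧ β = CategoryTheory.CategoryStruct.comp υ' β₉ ∧ T' = closure (υ' ⁻¹' (T₉ \ Z₉))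

end Summit.ResolutionOfSingularities.ResolutionOfSingularities.Cruxes.EquisingularLiftNat.Sections

end
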